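import Literature.AlgebraicGeometry.ShimuraVarieties.KudlaRapoport2013.Sec1NotationConventions
import Literature.NumberTheory.QuadraticFields.HeegnerCondition
import Mathlib.NumberTheory.NumberField.Norm
import HarnessLib

/-!
# [KudlaRapoport2013, §1 «Notation and conventions», (1.3) (arXiv v2 p. 7)] «An `O_k`-lattice in `V` is self-dual for `( , )`
# if and only if it is self-dual for `⟨ , ⟩`» — DISCHARGED: `KR2013_1_selfDual_iff_holds`

Kernel-lane companion of the statement carpet ★
`Literature/AlgebraicGeometry/ShimuraVarieties/KudlaRapoport2013/Sec1NotationConventions.lean`: its CLOSED named fact ★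
`KR2013_1_selfDual_iff` — S. Kudla, M. Rapoport, *Special cycles on unitary Shimura varieties II: global theory*, J. reine
angew. Math. 697 (2014) 91–157 = arXiv:0912.3758v2, §1 p. 7: «For a hermitian space `V` over `k`, there is an associated
alternating form defined by `⟨x, y⟩ = tr((x, y)/√Δ)` […] An `O_k`-lattice in `V` is self-dual for `( , )` if and only if it is
self-dual for `⟨ , ⟩`.», typed for every `δ` with `δ² = Δ`, every Gram matrix `J` and every `O_k`-submodule `L ⊆ kⁿ` — is PROVED
here.  THEOREMS ONLY (no definition, no named fact, no `sorry`, no instance, no notation); cell hodgecm-mathlib, seat B-typ04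
(g31); net debt −1.

## The proof

KR give no proof; the carpet's docstring records the reason («`(x, L)/δ` is an `O_k`-module, whose traces are integral iff it
lies in the inverse different `𝔡_k⁻¹ = δ⁻¹ O_k`»).  We prove exactly this pointwise statement — for each `x`,
`(x, L) ⊆ O_k ⟺ Tr((x, L)/δ) ⊆ ℤ` — by an explicit computation in an integral basis, avoiding the different (not available
for quadratic fields in Mathlib): the tree's ★ `QuadraticFields.Quadratic.exists_basis_zero_eq_one` gives a `ℤ`-basis
`(1, ω)` of `O_k` with `ω² = m + tω`, `Δ = t² + 4m` (★ `discr_eq_sq_add_four_mul`), so `δ = ±δ₀`, `δ₀ = 2ω − t`, and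
`Tr(1) = 2`, `Tr(ω) = t` (`trace_coord`).
* (⇒) for `z = a + cω ∈ O_k`, `z δ₀ = (2cm − at) + (2a + ct)ω` has trace `cΔ`, and `z/δ₀ = Δ⁻¹ z δ₀`, so `Tr(z/δ) = ±c ∈ ℤ`.
* (⇐) if `Tr(u), Tr(ωu) ∈ ℤ` for `u = c + dω ∈ k` then `u δ₀ = (Tr(ωu) − t Tr(u)) + Tr(u) ω ∈ O_k`.  The second trace is
  available because `⟨x, L⟩ ⊆ ℤ` is stable under `y ↦ a y`, `a ∈ O_k`, with `(x, a y) = a^σ (x, y)` and `σ(t − ω) = ω`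
  (`conj_omega`: `σ(ω)` is the other root `t − ω` of `X² − tX − m`, since `σ ≠ 1`).

## References
* [KudlaRapoport2013] S. Kudla, M. Rapoport, *Special cycles on unitary Shimura varieties II: global theory*, J. reine angew.
  Math. 697 (2014) 91–157; arXiv:0912.3758v2, §1 (1.3) (p. 7).
* [Neukirch1999] J. Neukirch, *Algebraic Number Theory*, Ch. III §2 (the inverse different as the trace dual of `O_k`).
-/

set_option autoImplicit false

noncomputable section

open NumberField Module
open scoped nonZeroDivisors

namespace Literature.AlgebraicGeometry.ShimuraVarieties.KudlaRapoport2013.Sec1NotationConventions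

open Literature.NumberTheory.Automorphic.Liu2021.AppendixC (conj conj_ne_one)
open Literature.AlgebraicGeometry.ShimuraVarieties.KudlaRapoport2013.Sec3ComplexUniformization (krForm IsSelfDualFor)
open Literature.NumberTheory.QuadraticFields.Quadratic (exists_basis_zero_eq_one basis_one_mul_self_eq
  discr_eq_sq_add_four_mul)

section Forms

variable {k : Type} [Field k]

/-- `( , )` is `σ`-antilinear in the second variable: `(x, b y) = b^σ (x, y)`. [folklore] -/
private theorem krForm_smul_right' {n : ℕ} (σ : k →+* k) (J : Matrix (Fin n) (Fin n) k) (b : k)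
    (x y : Fin n → k) : krForm σ J x (b • y) = σ b * krForm σ J x y := by
  have h : (⇑σ ∘ (b • y)) = σ b • (⇑σ ∘ y) := by
    funext i
    simp [smul_eq_mul, map_mul]
  simp [krForm, h, smul_dotProduct, smul_eq_mul]

end Forms

section Quadratic

variable {k : Type} [Field k] [NumberField k]

/-- Traces in the integral basis `(1, ω)`, `ω² = m + tω`: `Tr(c + dω) = 2c + dt` for `c, d ∈ ℚ` (`Tr(1) = [k:ℚ] = 2`, `Tr(ω) = t`
from the matrix of `ω` on `(1, ω)`). [folklore] -/
private theorem trace_coord (h2 : finrank ℚ k = 2) (b : Basis (Fin 2) ℤ (𝓞 k)) (hb : b 0 = 1) (c d : ℚ) :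
    Algebra.trace ℚ k ((c : k) + (d : k) * ((b 1 : 𝓞 k) : k)) = 2 * c + d * (b.repr (b 1 * b 1) 1 : ℚ) := by
  set ω := b 1 with hω
  set t : ℤ := b.repr (ω * ω) 1
  have hrepr0 : b.repr ω 0 = 0 := by
    rw [hω, b.repr_self]
    simp
  have trω : Algebra.trace ℤ (𝓞 k) ω = t := by
    rw [Algebra.trace_eq_matrix_trace b, Matrix.trace_fin_two, Algebra.leftMulMatrix_eq_repr_mul,
      Algebra.leftMulMatrix_eq_repr_mul, hb, mul_one, hrepr0, zero_add]
  have trωQ : Algebra.trace ℚ k (ω : k) = (t : ℚ) := by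
    rw [← Algebra.coe_trace_int, trω]
  have tr1 : Algebra.trace ℚ k (1 : k) = 2 := by
    rw [← (algebraMap ℚ k).map_one, Algebra.trace_algebraMap, h2]
    norm_num
  rw [← Rat.smul_one_eq_cast k c, show (d : k) * (ω : k) = d • (ω : k) from (Rat.smul_def d _).symm, map_add,
    map_smul, map_smul, tr1, trωQ, smul_eq_mul, smul_eq_mul]
  ring

end Quadratic

section Conj

variable {k : Type} [Field k] [NumberField k] [IsTotallyComplex k] [Algebra.IsQuadraticExtension ℚ k]

/-- `σ(ω) = t − ω`: `σ(ω)` is a root of `X² − tX − m = (X − ω)(X − (t − ω))`, and `σ(ω) = ω` would force `σ = 1` on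
`k = ℚ·1 ⊕ ℚ·ω`. [folklore] -/
private theorem conj_omega (b : Basis (Fin 2) ℤ (𝓞 k)) (hb : b 0 = 1) :
    conj ℚ k ((b 1 : 𝓞 k) : k) = (b.repr (b 1 * b 1) 1 : k) - ((b 1 : 𝓞 k) : k) := by
  set ω := b 1 with hω
  set m : ℤ := b.repr (ω * ω) 0
  set t : ℤ := b.repr (ω * ω) 1
  have hωω : (ω : k) * ω = (m : k) + (t : k) * ω := by
    have h := congrArg (fun z : 𝓞 k => (z : k)) (basis_one_mul_self_eq b hb)
    simpa using h
  set s := conj ℚ k (ω : k) with hs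
  have hss : s * s = (m : k) + (t : k) * s := by
    have h := congrArg (conj ℚ k) hωω
    simpa [map_mul, map_add, map_intCast] using h
  -- `(s − ω)(s − (t − ω)) = 0`
  have hprod : (s - ω) * (s - ((t : k) - ω)) = 0 := by linear_combination hss - hωω
  rcases mul_eq_zero.mp hprod with h | h
  · -- `σ(ω) = ω` forces `σ = 1`
    exfalso
    apply conj_ne_one ℚ k
    have hsω : conj ℚ k (ω : k) = ω := sub_eq_zero.mp h
    -- `k` is spanned over `ℚ` by `1, ω`
    let B : Basis (Fin 2) ℚ k := b.localizationLocalization ℚ ℤ⁰ k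
    have hB0 : B 0 = 1 := by simp [B, hb]
    have hB1 : B 1 = (ω : k) := by simp [B, hω]
    refine AlgEquiv.ext fun u => ?_
    have hu := B.sum_repr u
    rw [Fin.sum_univ_two, hB0, hB1, Rat.smul_one_eq_cast, Rat.smul_def] at hu
    rw [← hu, map_add, map_mul, map_ratCast, map_ratCast, hsω]
    rfl
  · exact sub_eq_zero.mp h

end Conj

/-- ★ `KR2013_1_selfDual_iff` HOLDS. [KudlaRapoport2013 §1 (1.3), arXiv v2 p. 7]: «An `O_k`-lattice in `V` is self-dual for `( , )`
if and only if it is self-dual for `⟨ , ⟩`» (`⟨x, y⟩ = tr((x, y)/√Δ)`), for every `δ ∈ k` with `δ² = Δ`, every Gram matrix `J`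
and every `O_k`-submodule `L ⊆ kⁿ`.  Pointwise: `(x, L) ⊆ O_k ⟺ Tr((x, L)/δ) ⊆ ℤ`, by the integral-basis computation
(`ω² = m + tω`, `δ = ±(2ω − t)`, `Tr(1) = 2`, `Tr(ω) = t`) — the inverse different of the quadratic field is `δ⁻¹ O_k`.
[cite: KudlaRapoport2013, §1 Notation and conventions (1.3) (arXiv v2 p. 7)] -/
theorem KR2013_1_selfDual_iff_holds : KR2013_1_selfDual_iff := by
  intro k _ _ _ _ δ hδ n J L
  classical
  have h2 : finrank ℚ k = 2 := Algebra.IsQuadraticExtension.finrank_eq_two ℚ k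
  obtain ⟨b, hb⟩ := exists_basis_zero_eq_one (K := k) h2
  -- the integral basis `(1, ω)`, `ω² = m + tω`, `Δ = t² + 4m`, `δ₀ = 2ω − t`
  set ωi : 𝓞 k := b 1 with hωi
  set m : ℤ := b.repr (ωi * ωi) 0 with hm
  set t : ℤ := b.repr (ωi * ωi) 1 with ht
  set ω : k := (ωi : k) with hω
  have hωω : ω * ω = (m : k) + (t : k) * ω := by
    have h := congrArg (fun z : 𝓞 k => (z : k)) (basis_one_mul_self_eq b hb)
    simpa [hω] using h
  have hΔZ : NumberField.discr k = t ^ 2 + 4 * m := discr_eq_sq_add_four_mul b hb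
  have hΔZne : t ^ 2 + 4 * m ≠ 0 := by
    rw [← hΔZ]
    exact NumberField.discr_ne_zero k
  set Δq : ℚ := (t : ℚ) ^ 2 + 4 * m with hΔq
  have hΔne : Δq ≠ 0 := by
    rw [hΔq]
    exact_mod_cast hΔZne
  set δ₀ : k := 2 * ω - (t : k) with hδ₀
  have hδ₀sq : δ₀ * δ₀ = (Δq : k) := by
    rw [hΔq, hδ₀]
    push_cast
    linear_combination (4 : k) * hωω
  have hδ₀ne : δ₀ ≠ 0 := by
    intro h
    rw [h, mul_zero] at hδ₀sq
    exact hΔne (by exact_mod_cast hδ₀sq.symm)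
  have hδcases : δ = δ₀ ∨ δ = -δ₀ := by
    apply eq_or_eq_neg_of_sq_eq_sq
    rw [hδ, sq, hδ₀sq, hΔZ, hΔq]
    push_cast
    ring
  -- `1/δ₀ = Δ⁻¹ δ₀`
  have hinv : ∀ w : k, w / δ₀ = (Δq⁻¹ : ℚ) • (w * δ₀) := by
    intro w
    calc w / δ₀ = w * δ₀ / (δ₀ * δ₀) := (mul_div_mul_right w δ₀ hδ₀ne).symm
      _ = (Δq⁻¹ : ℚ) • (w * δ₀) := by rw [hδ₀sq, Rat.smul_def, Rat.cast_inv, div_eq_inv_mul]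
  -- traces in coordinates
  have htr : ∀ c d : ℚ, Algebra.trace ℚ k ((c : k) + (d : k) * ω) = 2 * c + d * t := fun c d =>
    trace_coord h2 b hb c d
  -- (⇒) `z ∈ O_k ⇒ Tr(z/δ₀) ∈ ℤ`
  have trace_div_mem_of_mem : ∀ z : 𝓞 k, ∃ c : ℤ, Algebra.trace ℚ k ((z : k) / δ₀) = c := by
    intro z
    have hz := b.sum_repr z
    rw [Fin.sum_univ_two, hb] at hz
    set a : ℤ := b.repr z 0
    set c : ℤ := b.repr z 1
    have hzk : (z : k) = (a : k) + (c : k) * ω := by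
      rw [← hz]
      simp [zsmul_eq_mul, hω, hωi]
    refine ⟨c, ?_⟩
    have hzδ : (z : k) * δ₀ = ((2 * c * m - a * t : ℚ) : k) + ((2 * a + c * t : ℚ) : k) * ω := by
      rw [hzk, hδ₀]
      push_cast
      linear_combination (2 * (c : k)) * hωω
    rw [hinv, map_smul, hzδ, htr, smul_eq_mul, inv_mul_eq_iff_eq_mul₀ hΔne, hΔq]
    ring
  -- (⇐) `Tr(u), Tr(ωu) ∈ ℤ ⇒ u δ₀ ∈ O_k`
  have mul_mem_of_trace : ∀ u : k, (∃ A : ℤ, Algebra.trace ℚ k u = A) → (∃ B : ℤ, Algebra.trace ℚ k (ω * u) = B) →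
      ∃ w : 𝓞 k, (w : k) = u * δ₀ := by
    rintro u ⟨A, hA⟩ ⟨B, hB⟩
    let Bq : Basis (Fin 2) ℚ k := b.localizationLocalization ℚ ℤ⁰ k
    have hB0 : Bq 0 = 1 := by simp [Bq, hb]
    have hB1 : Bq 1 = ω := by simp [Bq, hω, hωi]
    have hu := Bq.sum_repr u
    rw [Fin.sum_univ_two, hB0, hB1] at hu
    set c : ℚ := Bq.repr u 0
    set d : ℚ := Bq.repr u 1
    have huk : u = (c : k) + (d : k) * ω := by
      rw [← hu, Rat.smul_one_eq_cast, Rat.smul_def]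
    have hA' : 2 * c + d * t = A := by rw [← htr, ← huk, hA]
    have hωu : ω * u = ((d * m : ℚ) : k) + ((c + d * t : ℚ) : k) * ω := by
      rw [huk]
      push_cast
      linear_combination (d : k) * hωω
    have hB' : 2 * (d * m) + (c + d * t) * t = B := by rw [← htr, ← hωu, hB]
    refine ⟨(B - t * A : ℤ) + (A : ℤ) * ωi, ?_⟩
    have e1 : (((B - t * A : ℤ) : ℚ) : k) = ((2 * d * m - c * t : ℚ) : k) := by
      congr 1
      push_cast
      linear_combination (t : ℚ) * hA' - hB'
    have e2 : (((A : ℤ) : ℚ) : k) = ((2 * c + d * t : ℚ) : k) := by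
      congr 1
      rw [← hA']
    have hcast1 : (((B - t * A : ℤ) : 𝓞 k) : k) = (((B - t * A : ℤ) : ℚ) : k) := by simp
    have hcast2 : (((A : ℤ) : 𝓞 k) : k) = (((A : ℤ) : ℚ) : k) := by simp
    rw [show ((((B - t * A : ℤ) : 𝓞 k) + ((A : ℤ) : 𝓞 k) * ωi : 𝓞 k) : k)
        = (((B - t * A : ℤ) : 𝓞 k) : k) + (((A : ℤ) : 𝓞 k) : k) * ω by simp [hω], hcast1, hcast2, e1, e2, huk, hδ₀]
    push_cast
    linear_combination (-(2 : k) * d) * hωω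
  -- an `a ∈ O_k` with `a^σ = ω`
  have hconjω : conj ℚ k ω = (t : k) - ω := conj_omega b hb
  set aσ : 𝓞 k := (t : 𝓞 k) - ωi with haσ
  have hcoe : algebraMap (𝓞 k) k aσ = (t : k) - ω := by
    rw [haσ, map_sub, map_intCast, hω, RingOfIntegers.coe_eq_algebraMap]
  have haσk : (conj ℚ k : k →+* k) (algebraMap (𝓞 k) k aσ) = ω := by
    rw [hcoe, map_sub, map_intCast]
    show (t : k) - conj ℚ k ω = ω
    rw [hconjω]
    ring
  -- pointwise equivalence
  have key : ∀ x : Fin n → k,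
      (∀ y ∈ L, krForm (conj ℚ k : k →+* k) J x y ∈ (algebraMap (𝓞 k) k).range) ↔
        (∀ y ∈ L, tracePairing δ J x y ∈ (Int.castRingHom ℚ).range) := by
    intro x
    constructor
    · intro h y hy
      obtain ⟨z, hz⟩ := h y hy
      obtain ⟨c, hc⟩ := trace_div_mem_of_mem z
      unfold tracePairing
      rw [← hz]
      rcases hδcases with hδ' | hδ'
      · exact ⟨c, by rw [hδ']; exact_mod_cast hc.symm⟩
      · refine ⟨-c, ?_⟩
        rw [hδ', div_neg, map_neg]
        simp [hc]
    · intro h y hy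
      set z := krForm (conj ℚ k : k →+* k) J x y with hz
      -- `Tr(z/δ) ∈ ℤ` and, from `(x, a y) = a^σ (x, y)` with `a^σ = ω`, `Tr(ω z/δ) ∈ ℤ`
      obtain ⟨A, hA⟩ := h y hy
      obtain ⟨B, hB⟩ := h (aσ • y) (L.smul_mem aσ hy)
      unfold tracePairing at hA hB
      rw [← algebraMap_smul k aσ y, krForm_smul_right', haσk] at hB
      -- reduce to `δ₀`
      have hu : ∃ w : 𝓞 k, (w : k) = z / δ₀ * δ₀ := by
        apply mul_mem_of_trace
        · rcases hδcases with hδ' | hδ'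
          · exact ⟨A, by rw [← hδ']; exact_mod_cast hA.symm⟩
          · refine ⟨-A, ?_⟩
            have : z / δ₀ = -(z / δ) := by rw [hδ', div_neg, neg_neg]
            rw [this, map_neg]
            simp [← hA, hz]
        · rcases hδcases with hδ' | hδ'
          · refine ⟨B, ?_⟩
            rw [← mul_div_assoc, ← hδ']
            exact_mod_cast hB.symm
          · refine ⟨-B, ?_⟩
            have : ω * (z / δ₀) = -(ω * z / δ) := by rw [hδ', div_neg, mul_div_assoc, neg_neg]
            rw [this, map_neg]
            simp [← hB, hz]
      obtain ⟨w, hw⟩ := hu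
      rw [div_mul_cancel₀ _ hδ₀ne] at hw
      exact ⟨w, hw⟩
  constructor
  · intro hsd x
    exact (hsd x).trans (key x)
  · intro hsd x
    exact (hsd x).trans (key x).symm

end Literature.AlgebraicGeometry.ShimuraVarieties.KudlaRapoport2013.Sec1NotationConventions
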